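import Mathlib

/-!
# Isolating one isotypic component by the Hecke algebra (T3.1 §4.3 (b4), seat t3-p1)

The spectral step (b4) of the period closer: the two wedges `θ₀ ∧ θ₁` and `θ₂ ∧ θ₃` decompose
over the automorphic representations `π` of `U(V)` at level `K`; if for some `π₀` both
components are non-zero, some Hecke operator `h ∈ H(K)` makes `⟨h·(θ₀∧θ₁), θ₂∧θ₃⟩ ≠ 0`.
The algebra behind it, with `R` in the role of the Hecke algebra acting on the finite-dimensional
semisimple module `M = H^{2,0}(Sh(G)_K)`, `N = π₀`'s isotypic component (a simple `R`-module),
`N'` the sum of the other components, and `B` the Hodge pairing (orthogonal across components,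
non-degenerate on `N`): Jacobson density (Mathlib `jacobson_density`) puts the projector onto `N`
into `R` on any finite set (the projector is built inline, so the file declares no definition), and the simplicity of `N` moves `u_N` to a vector pairing non-trivially
with `u'_N`.  Hypotheses are stated for an abstract ring `R`; nothing is specific to Hecke algebras.  The
stability of `N` and `N'` under `Module.End R M` encodes multiplicity one (the `π₀`-isotypic
component is a single copy `Θ(τ₀)` and the other components contain no copy of it); this is
Rogawski's multiplicity one for `U(3)` in the application.
-/

namespace HodgeRepro.T3P1

open Module Submodule

variable {R : Type*} [Ring R] {M : Type*} [AddCommGroup M] [Module R M]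

/-- If the complementary submodules `N`, `N'` are both stable under every `R`-endomorphism of
`M`, the projection onto `N` along `N'` commutes with every `R`-endomorphism. -/
theorem projection_comp_comm (N N' : Submodule R M) (h : IsCompl N N')
    (hN : ∀ f : Module.End R M, ∀ x ∈ N, f x ∈ N)
    (hN' : ∀ f : Module.End R M, ∀ x ∈ N', f x ∈ N') (f : Module.End R M) (x : M) :
    N.projection N' h (f x) = f (N.projection N' h x) := by
  have hx : x = N.projection N' h x + N'.projection N h.symm x :=
    (projection_add_projection_eq_self h x).symm
  have h1 : N.projection N' h (f (N.projection N' h x)) = f (N.projection N' h x) :=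
    projection_apply_of_mem_left h (hN f _ (projection_apply_mem h x))
  have h2 : N.projection N' h (f (N'.projection N h.symm x)) = 0 :=
    projection_apply_of_mem_right h (hN' f _ (projection_apply_mem h.symm x))
  calc N.projection N' h (f x)
      = N.projection N' h (f (N.projection N' h x) + f (N'.projection N h.symm x)) := by
        conv_lhs => rw [hx, map_add]
    _ = f (N.projection N' h x) := by rw [map_add, h1, h2, add_zero]

/-- In a semisimple `R`-module, an element of the isotypic component `N` is the image of any
given `u` under some `r ∈ R` as soon as it is the `N`-component of `u` (Jacobson density). -/
theorem exists_smul_eq_projection [IsSemisimpleModule R M] (N N' : Submodule R M)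
    (h : IsCompl N N') (hN : ∀ f : Module.End R M, ∀ x ∈ N, f x ∈ N)
    (hN' : ∀ f : Module.End R M, ∀ x ∈ N', f x ∈ N') (u : M) :
    ∃ r : R, r • u = N.projection N' h u := by
  -- the projector onto `N` along `N'` as an endomorphism of `M` over `Module.End R M`
  let P : Module.End (Module.End R M) M :=
    { toFun := N.projection N' h
      map_add' := map_add _
      map_smul' := fun f x =>
        show N.projection N' h (f x) = f (N.projection N' h x) from
          projection_comp_comm N N' h hN hN' f x }
  obtain ⟨r, hr⟩ := jacobson_density P {u}
  exact ⟨r, (hr u (Finset.mem_singleton_self u)).symm⟩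

/-- A non-zero element of a simple submodule `N` generates it: every `y ∈ N` is `r • n`. -/
theorem exists_smul_eq_of_isSimpleModule (N : Submodule R M) [IsSimpleModule R N]
    {n : M} (hn : n ∈ N) (hn0 : n ≠ 0) {y : M} (hy : y ∈ N) : ∃ r : R, r • n = y := by
  let S : Submodule R N := (Submodule.span R {n}).comap N.subtype
  have hS : S ≠ ⊥ := by
    intro hbot
    have : (⟨n, hn⟩ : N) ∈ S := by
      show n ∈ Submodule.span R {n}
      exact Submodule.mem_span_singleton_self n
    rw [hbot, Submodule.mem_bot] at this
    exact hn0 (congrArg Subtype.val this)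
  have hS' : S = ⊤ := (eq_bot_or_eq_top S).resolve_left hS
  have : (⟨y, hy⟩ : N) ∈ S := by rw [hS']; exact Submodule.mem_top
  exact Submodule.mem_span_singleton.mp this

/-- THE ISOLATION LEMMA. `M` semisimple over `R`; `N` a simple submodule with a complement `N'`,
both stable under `Module.End R M` (the isotypic situation); `B : M → M → k` additive in its
second argument, vanishing on `N × N'`, and non-degenerate on `N` in the sense that every
non-zero `y ∈ N` pairs non-trivially with some `x ∈ N`.  If the `N`-components of `u` and `u'`
are both non-zero, then some `r ∈ R` has `B (r • u) u' ≠ 0`. -/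
theorem exists_smul_pairing_ne_zero [IsSemisimpleModule R M] {k : Type*} [AddCommGroup k]
    (N N' : Submodule R M) (h : IsCompl N N') [IsSimpleModule R N]
    (hN : ∀ f : Module.End R M, ∀ x ∈ N, f x ∈ N)
    (hN' : ∀ f : Module.End R M, ∀ x ∈ N', f x ∈ N')
    (B : M → M → k) (hBadd : ∀ x y z, B x (y + z) = B x y + B x z)
    (hBorth : ∀ x ∈ N, ∀ y ∈ N', B x y = 0)
    (hBnd : ∀ y ∈ N, y ≠ 0 → ∃ x ∈ N, B x y ≠ 0)
    (u u' : M) (hu : N.projection N' h u ≠ 0) (hu' : N.projection N' h u' ≠ 0) :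
    ∃ r : R, B (r • u) u' ≠ 0 := by
  obtain ⟨r₀, hr₀⟩ := exists_smul_eq_projection N N' h hN hN' u
  obtain ⟨x, hxN, hx⟩ := hBnd _ (projection_apply_mem h u') hu'
  obtain ⟨r₁, hr₁⟩ :=
    exists_smul_eq_of_isSimpleModule N (projection_apply_mem h u) hu hxN
  refine ⟨r₁ * r₀, ?_⟩
  have hsplit : u' = N.projection N' h u' + N'.projection N h.symm u' :=
    (projection_add_projection_eq_self h u').symm
  rw [mul_smul, hr₀, hr₁, hsplit, hBadd,
    hBorth x hxN _ (projection_apply_mem h.symm u'), add_zero]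
  exact hx

/-- The one-component case, used for (b5) at a finite place: in a simple `R`-module `N`
(`N := π_v`, `R` acting through `U(V_v)`) with a pairing `B` that is non-degenerate in the sense
«every non-zero `y` pairs non-trivially with some `x`», any two non-zero vectors `x₀, y₀` have
`B (r • x₀) y₀ ≠ 0` for some `r ∈ R`. -/
theorem exists_smul_pairing_ne_zero_of_isSimpleModule {k : Type*}
    {N : Type*} [AddCommGroup N] [Module R N] [IsSimpleModule R N]
    (B : N → N → k) [Zero k] (hBnd : ∀ y : N, y ≠ 0 → ∃ x : N, B x y ≠ 0)
    {x₀ y₀ : N} (hx₀ : x₀ ≠ 0) (hy₀ : y₀ ≠ 0) : ∃ r : R, B (r • x₀) y₀ ≠ 0 := by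
  obtain ⟨x, hx⟩ := hBnd y₀ hy₀
  have hS : (Submodule.span R {x₀} : Submodule R N) ≠ ⊥ := by
    intro hbot
    have : x₀ ∈ Submodule.span R {x₀} := Submodule.mem_span_singleton_self x₀
    rw [hbot, Submodule.mem_bot] at this
    exact hx₀ this
  have hS' : Submodule.span R {x₀} = ⊤ := (eq_bot_or_eq_top _).resolve_left hS
  have hxmem : x ∈ Submodule.span R {x₀} := by rw [hS']; exact Submodule.mem_top
  obtain ⟨r, hr⟩ := Submodule.mem_span_singleton.mp hxmem
  exact ⟨r, by rw [hr]; exact hx⟩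

end HodgeRepro.T3P1
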